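import Summits.CriticalPhenomena.CardyFormulaZ2.Theorems.CardyMagicRigidityMarkovCascadeDefs
import Summits.CriticalPhenomena.CardyFormulaZ2.Theorems.CardyMagicRigidityNestingRigidityKernelTransferFamilies
import Summits.CriticalPhenomena.CardyFormulaZ2.Theorems.CardyMagicRigidityNestingRigidityBondDuality
import Literature.Probability.Percolation.LoopRepresentationProofs
import Literature.Probability.Percolation.PlanarDuality
import Literature.Probability.Percolation.RSW
import HarnessLib

/-!
# Open boundary conditions on `ℤ²` are dual closed boundary conditions, in law
# (helper toward line `markov-cascade-one-generation`, crux `NestingRigidity`,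
# stmt-CriticalPhenomena-4835)

Route `CardyMagicRigidity` (sub-problem `CriticalPhenomena/CardyFormulaZ2`), crux
`Summit.CriticalPhenomena.CardyFormulaZ2.Theses.CardyMagicRigidity.NestingRigidity`, line
`markov-cascade-one-generation` (vocabulary: `Theorems/CardyMagicRigidityMarkovCascadeDefs.lean`).
Registered stub `cnLawEDist_openBC_duality_Z2` (type-swap step of the Markov cascade on `ℤ²`):
the OPEN-b.c. domain ensemble of a set of edges `M` (every lattice edge off `M` declared open,
typed interface loops drawn by `loopCurve δ 0`, restricted to the loops visiting an edge of `M`)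
has, in DKKMO's coupling distance `d_CN` and under critical bond percolation `P2`, distance `0`
from the TYPE-SWAPPED, HALF-MESH-SHIFTED (`+δ(1+i)/2`) closed-b.c. ensemble of the dual-indexed
edge set `dualEdge '' M`.

Proof.  Couple `ω` with its dual configuration `dualConfig ω` (`Crossings.lean`); the second
marginal is again `P2` by self-duality at `p = 1/2` (`bondPercolation_map_dualConfig_holds`,
`symm_half`).  The set identity `dualConfig (ω ∪ (E ∖ M)) = dualConfig ω ∩ dualEdge '' M`
(`dualConfig_union_edgeSet_diff`; `dualEdge` permutes the lattice edges and is the identity off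
them) identifies the closed-b.c. configuration of the dual side with the dual of the open-b.c.
configuration, so by the configuration-level duality of the landed module
`CardyMagicRigidityNestingRigidityBondDuality` (`isInterfaceLoop_dualConfig`,
`isInterfaceLoop_of_dualConfig`, `medialPoint_dualEdge`,
`unbasedLoop_loopCurve_map_reverse_translate`, `loopSignedArea_map_reverse_translate`,
`loopType_eq_iff_of_neg`) every loop of one ensemble is the REVERSAL of a loop of the other with
the same type index (after the relabelling `i ↦ 1 - i`).  DKKMO's relation `d_CN ≤ ε` only uses
the unoriented loop distance, so the two coupled configurations are `ε`-close for every `ε ≥ 0`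
(`IsClose.of_forall_mem_or_reverse_mem`), surely; the exceptional event is contained in the
measurable null set `{ω' ≠ dualConfig ω}` and `cnLawEDist_le_of_coupling` concludes.
-/

noncomputable section

open MeasureTheory Set Filter
open scoped Topology BigOperators ENNReal Real

namespace Summit.CriticalPhenomena.CardyFormulaZ2.Cruxes.NestingRigidity.MarkovCascadeOneGeneration

open Literature.Probability.RandomPlanarGeometry Literature.Probability.Percolation
  Literature.Probability.LatticeModels
open Summit.CriticalPhenomena.CardyFormulaZ2.Theses.CardyMagicRigidity

/-! ### The dual of an open boundary condition is a closed boundary condition -/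

/-- **Duality exchanges open and closed boundary conditions**: declaring every lattice edge off
`M` open and dualising gives the dual configuration with every edge off `dualEdge '' M` closed.
(`dualEdge` permutes `E(ℤ²)` and is the identity off it, `dualConfig ω ⊆ E(ℤ²)`.) [folklore] -/
theorem dualConfig_union_edgeSet_diff (ω M : Set (Sym2 (Site 2))) :
    dualConfig (ω ∪ ((zdGraph 2).edgeSet \ M)) = dualConfig ω ∩ dualEdge '' M := by
  ext e
  rw [dualConfig_eq, dualConfig_eq]
  simp only [mem_setOf_eq, mem_inter_iff, mem_union, Set.mem_sdiff, mem_image, not_or, not_and,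
    not_not]
  constructor
  · rintro ⟨hE, hω, hM⟩
    have hE' : dualEdgeEquiv.symm e ∈ (zdGraph 2).edgeSet := by
      rw [← dualEdge_mem_edgeSet_iff, ← dualEdgeEquiv_apply, Equiv.apply_symm_apply]
      exact hE
    exact ⟨⟨hE, hω⟩, dualEdgeEquiv.symm e, hM hE', by
      rw [← dualEdgeEquiv_apply, Equiv.apply_symm_apply]⟩
  · rintro ⟨⟨hE, hω⟩, m, hm, rfl⟩
    refine ⟨hE, hω, fun _ ↦ ?_⟩
    rw [← dualEdgeEquiv_apply, Equiv.symm_apply_apply]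
    exact hm

/-- Translating by `-c` and then by `c` is the identity on unbased loops. [folklore] -/
theorem map_translate_neg_map_translate (u : UnbasedLoop ℂ) (c : ℂ) :
    (u.map ⟨fun w ↦ 1 * w + -c, continuous_translate (-c)⟩ (isometry_translate (-c))).map
      ⟨fun w ↦ 1 * w + c, continuous_translate c⟩ (isometry_translate c) = u := by
  obtain ⟨ℓ, rfl⟩ := UnbasedLoop.mk_surjective u
  rw [UnbasedLoop.map_mk, UnbasedLoop.map_mk, BasedLoop.map_map]
  have hid : (⟨fun w ↦ 1 * w + c, continuous_translate c⟩ : C(ℂ, ℂ)).comp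
      ⟨fun w ↦ 1 * w + -c, continuous_translate (-c)⟩ = ContinuousMap.id ℂ := by
    ext w
    simp
  rw [hid, BasedLoop.map_id]

/-! ### Loop correspondence: open-b.c. loops of `ω` ↔ reversed closed-b.c. loops of the dual -/

/-- **Open-b.c. loop ↦ dual closed-b.c. loop.** A typed interface loop of `ω ∪ (E ∖ M)` visiting
`M`, reversed, is a member of the type-swapped, half-mesh-shifted closed-b.c. ensemble of
`dualConfig ω` on `dualEdge '' M` (witness: the loop read backwards through `dualEdge`).
[folklore] -/
theorem reverse_mem_dualSide {M : Set (Sym2 (Site 2))} {δ : ℝ} {ω : BondConfig (Site 2)}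
    {i : Fin 2} {u : UnbasedLoop ℂ}
    (hu : u ∈ {u | ∃ (γ : List MedialVertex)
      (h : IsInterfaceLoop (ω ∪ ((zdGraph 2).edgeSet \ M)) γ),
      loopType γ = i ∧ (∃ e ∈ γ, e ∈ M) ∧
        u = UnbasedLoop.mk (BasedLoop.mk (loopCurve δ 0 γ) (isLoop_loopCurve δ 0 h.ne_nil))}) :
    u.reverse ∈ {u | ∃ (γ : List MedialVertex)
      (h : IsInterfaceLoop (dualConfig ω ∩ dualEdge '' M) γ),
      loopType γ = 1 - i ∧ (∃ e ∈ γ, e ∈ dualEdge '' M) ∧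
        u = (UnbasedLoop.mk (BasedLoop.mk (loopCurve δ 0 γ) (isLoop_loopCurve δ 0 h.ne_nil))).map
          ⟨fun w ↦ 1 * w + δ * (1 + Complex.I) / 2, continuous_translate (δ * (1 + Complex.I) / 2)⟩
          (isometry_translate (δ * (1 + Complex.I) / 2))} := by
  obtain ⟨γ, h, hti, ⟨e, heγ, heM⟩, rfl⟩ := hu
  have h' : IsInterfaceLoop (dualConfig ω ∩ dualEdge '' M) ((γ.map dualEdge).reverse) := by
    rw [← dualConfig_union_edgeSet_diff]
    exact isInterfaceLoop_dualConfig h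
  have hE : ∀ e ∈ γ, e ∈ (zdGraph 2).edgeSet := fun e he ↦ mem_edgeSet_of_mem_interfaceLoop h he
  refine ⟨_, h', ?_, ⟨dualEdge e, List.mem_reverse.2 (List.mem_map.2 ⟨e, heγ, rfl⟩),
    mem_image_of_mem _ heM⟩, ?_⟩
  · refine (loopType_eq_iff_of_neg h.loopSignedArea_ne_zero ?_ (1 - i)).2
      (by rw [sub_sub_cancel]; exact hti)
    exact loopSignedArea_map_reverse_translate fun e he ↦ medialPoint_dualEdge (hE e he) 1
  · rw [unbasedLoop_loopCurve_map_reverse_translate h.ne_nil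
      (fun e he ↦ medialPoint_dualEdge (hE e he) δ) (isLoop_loopCurve δ 0 h'.ne_nil)
      (isLoop_loopCurve δ 0 h.ne_nil), ← UnbasedLoop.reverse_map, map_translate_neg_map_translate]

/-- **Dual closed-b.c. loop ↦ open-b.c. loop.** A member of the type-swapped, half-mesh-shifted
closed-b.c. ensemble of `dualConfig ω` on `dualEdge '' M`, reversed, is a typed interface loop of
`ω ∪ (E ∖ M)` visiting `M` (witness: the loop read backwards through `dualEdge⁻¹`). [folklore] -/
theorem reverse_mem_openSide {M : Set (Sym2 (Site 2))} {δ : ℝ} {ω : BondConfig (Site 2)}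
    {i : Fin 2} {u : UnbasedLoop ℂ}
    (hu : u ∈ {u | ∃ (γ : List MedialVertex)
      (h : IsInterfaceLoop (dualConfig ω ∩ dualEdge '' M) γ),
      loopType γ = 1 - i ∧ (∃ e ∈ γ, e ∈ dualEdge '' M) ∧
        u = (UnbasedLoop.mk (BasedLoop.mk (loopCurve δ 0 γ) (isLoop_loopCurve δ 0 h.ne_nil))).map
          ⟨fun w ↦ 1 * w + δ * (1 + Complex.I) / 2, continuous_translate (δ * (1 + Complex.I) / 2)⟩
          (isometry_translate (δ * (1 + Complex.I) / 2))}) :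
    u.reverse ∈ {u | ∃ (γ : List MedialVertex)
      (h : IsInterfaceLoop (ω ∪ ((zdGraph 2).edgeSet \ M)) γ),
      loopType γ = i ∧ (∃ e ∈ γ, e ∈ M) ∧
        u = UnbasedLoop.mk (BasedLoop.mk (loopCurve δ 0 γ) (isLoop_loopCurve δ 0 h.ne_nil))} := by
  obtain ⟨γ', h', hti, ⟨e', he'γ, m, hm, rfl⟩, rfl⟩ := hu
  rw [← dualConfig_union_edgeSet_diff] at h'
  have h : IsInterfaceLoop (ω ∪ ((zdGraph 2).edgeSet \ M))
      ((γ'.map dualEdgeEquiv.symm).reverse) :=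
    isInterfaceLoop_of_dualConfig h'
  have hE : ∀ e ∈ γ', e ∈ (zdGraph 2).edgeSet := fun e he ↦ mem_edgeSet_of_mem_interfaceLoop h' he
  refine ⟨_, h, ?_, ⟨m, ?_, hm⟩, ?_⟩
  · refine (loopType_eq_iff_of_neg h'.loopSignedArea_ne_zero ?_ i).2 hti
    exact loopSignedArea_map_reverse_translate fun e he ↦ medialPoint_dualEdgeEquiv_symm (hE e he) 1
  · rw [List.mem_reverse, List.mem_map]
    exact ⟨dualEdge m, he'γ, by rw [← dualEdgeEquiv_apply, Equiv.symm_apply_apply]⟩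
  · exact (unbasedLoop_loopCurve_map_reverse_translate h'.ne_nil
      (fun e he ↦ medialPoint_dualEdgeEquiv_symm (hE e he) δ) (isLoop_loopCurve δ 0 h.ne_nil)
      (isLoop_loopCurve δ 0 h'.ne_nil)).symm

/-- **The coupled configurations are `ε`-close for every `ε ≥ 0`, surely**: every member of
either ensemble has its reversal, with the same type index, in the other, and `d_CN ≤ ε` compares
loops through the unoriented distance only (`IsClose.of_forall_mem_or_reverse_mem`,
`isClose_self`). [folklore] -/
theorem isClose_openSide_dualSide {ε : ℝ} (hε : 0 ≤ ε) (M : Set (Sym2 (Site 2))) (δ : ℝ)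
    (ω : BondConfig (Site 2)) :
    LoopConfig.IsClose ε
      (⟨fun i ↦ {u | ∃ (γ : List MedialVertex)
        (h : IsInterfaceLoop (ω ∪ ((zdGraph 2).edgeSet \ M)) γ),
        loopType γ = i ∧ (∃ e ∈ γ, e ∈ M) ∧
          u = UnbasedLoop.mk (BasedLoop.mk (loopCurve δ 0 γ) (isLoop_loopCurve δ 0 h.ne_nil))}⟩ :
        LoopConfig ℂ)
      (⟨fun i ↦ {u | ∃ (γ : List MedialVertex)
        (h : IsInterfaceLoop (dualConfig ω ∩ dualEdge '' M) γ),
        loopType γ = 1 - i ∧ (∃ e ∈ γ, e ∈ dualEdge '' M) ∧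
          u = (UnbasedLoop.mk (BasedLoop.mk (loopCurve δ 0 γ)
            (isLoop_loopCurve δ 0 h.ne_nil))).map
            ⟨fun w ↦ 1 * w + δ * (1 + Complex.I) / 2,
              continuous_translate (δ * (1 + Complex.I) / 2)⟩
            (isometry_translate (δ * (1 + Complex.I) / 2))}⟩ : LoopConfig ℂ) :=
  (LoopConfig.isClose_self hε _).of_forall_mem_or_reverse_mem
    (fun _ _ hu ↦ Or.inr (reverse_mem_dualSide hu)) (fun _ _ hu ↦ Or.inr (reverse_mem_openSide hu))

/-! ### The registered stub -/

/-- **Open b.c. on `ℤ²` = dual closed b.c., in law (`d_CN = 0`).** Under critical bond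
percolation `P2` on `ℤ²`, the open-b.c. domain ensemble of `U` at mesh `δ` (edges of
`E(ℤ²) ∖ meshEdges U δ` declared open, typed interface loops visiting an edge of `meshEdges U δ`)
and the type-swapped, `+δ(1+i)/2`-shifted closed-b.c. ensemble of the dual-indexed edge set
`dualEdge '' meshEdges U δ` are at coupling distance `0`: couple `ω` with `dualConfig ω` (second
marginal `P2` by self-duality at `1/2`, `bondPercolation_map_dualConfig_holds`, `symm_half`); the
coupled configurations are `ε`-close surely (`isClose_openSide_dualSide`), the exceptional event
lies in the measurable `P2 ∘ (id, dualConfig)⁻¹`-null set `{ω' ≠ dualConfig ω}`, and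
`cnLawEDist_le_of_coupling` applies for every `ε > 0`. -/
theorem cnLawEDist_openBC_duality_Z2 : ∀ (U : Set ℂ) (δ : ℝ), LoopConfig.cnLawEDist P2 (fun ω ↦ (⟨fun i ↦ {u | ∃ (γ : List MedialVertex) (h : IsInterfaceLoop (ω ∪ ((zdGraph 2).edgeSet \ meshEdges U δ)) γ), loopType γ = i ∧ (∃ e ∈ γ, e ∈ meshEdges U δ) ∧ u = UnbasedLoop.mk (BasedLoop.mk (loopCurve δ 0 γ) (isLoop_loopCurve δ 0 h.ne_nil))}⟩ : LoopConfig ℂ)) P2 (fun ω ↦ (⟨fun i ↦ {u | ∃ (γ : List MedialVertex) (h : IsInterfaceLoop (ω ∩ dualEdge '' meshEdges U δ) γ), loopType γ = 1 - i ∧ (∃ e ∈ γ, e ∈ dualEdge '' meshEdges U δ) ∧ u = (UnbasedLoop.mk (BasedLoop.mk (loopCurve δ 0 γ) (isLoop_loopCurve δ 0 h.ne_nil))).map ⟨fun w ↦ 1 * w + δ * (1 + Complex.I) / 2, continuous_translate (δ * (1 + Complex.I) / 2)⟩ (isometry_translate (δ * (1 + Complex.I) / 2))}⟩ : LoopConfig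 ℂ)) = 0 := by
  intro U δ
  refine le_antisymm (ENNReal.le_of_forall_pos_le_add fun ε hε _ ↦ ?_) bot_le
  rw [zero_add, ← ENNReal.ofReal_coe_nnreal]
  have hε' : (0 : ℝ) < ε := by exact_mod_cast hε
  have hf : Measurable fun ω : BondConfig (Site 2) ↦ (ω, dualConfig ω) :=
    measurable_id.prodMk measurable_dualConfig
  refine LoopConfig.cnLawEDist_le_of_coupling hε' (P2.map fun ω ↦ (ω, dualConfig ω)) ?_ ?_ ?_
  · rw [Measure.map_map measurable_fst hf]
    exact Measure.map_id
  · rw [Measure.map_map measurable_snd hf]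
    change P2.map dualConfig = P2
    exact (bondPercolation_map_dualConfig_holds half).trans (by rw [symm_half])
  · have hT : MeasurableSet
        {p : BondConfig (Site 2) × BondConfig (Site 2) | p.2 = dualConfig p.1}ᶜ := by
      haveI := standardBorelSpace_bondConfig
      exact (measurableSet_eq_fun measurable_snd (measurable_dualConfig.comp measurable_fst)).compl
    refine lt_of_le_of_lt (measure_mono
      (show _ ⊆ {p : BondConfig (Site 2) × BondConfig (Site 2) | p.2 = dualConfig p.1}ᶜ from ?_)) ?_
    · rintro ⟨ω, ω'⟩ hp (heq : ω' = dualConfig ω)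
      subst heq
      exact hp (isClose_openSide_dualSide hε'.le _ _ _)
    · rw [Measure.map_apply hf hT]
      have he : (fun ω : BondConfig (Site 2) ↦ (ω, dualConfig ω)) ⁻¹'
          {p : BondConfig (Site 2) × BondConfig (Site 2) | p.2 = dualConfig p.1}ᶜ = ∅ :=
        Set.eq_empty_of_forall_notMem fun ω h ↦ h rfl
      rw [he, measure_empty]
      exact ENNReal.ofReal_pos.2 hε'

end Summit.CriticalPhenomena.CardyFormulaZ2.Cruxes.NestingRigidity.MarkovCascadeOneGeneration

end
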